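import Summits.MatrixMultiplication.Statement
import Summits.MatrixMultiplication.MatrixMultiplication.Theses.IsotypicSaturation
import Literature.Computability.AlgebraicComplexity.SchoenhageTauDischarge
import Literature.Computability.AlgebraicComplexity.DegenerationSpectralMonotone

/-!
# Birth skeleton — crux `PolytopeInvariance` (piece 1 of the split of `PolytopeSaturation`,
route IsotypicSaturation): the ISOTYPIC-SLICE line

`PolytopeInvariance`: a universal spectral point `F` takes equal values on polytope-twins `s`, `t`
(tensors dominating each other: every partition triple occurring in a power of one has a multiple
occurring in the corresponding power of the other).

Line: compress `F(s)^n = F(s^{⊗n})` onto ONE isotypic slice `P_λ s^{⊗n}` (polynomial loss: the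
isotypic decomposition `s^{⊗n} = ∑_λ c_λ P_λ s^{⊗n}` has `poly(n)` nonzero summands by Schur–Weyl, and
`F` is subadditive under `+`), then bound the slice value by `F(t)^n` at exponential rate `2^{εn}`
using only that `λ` (if it occurs) has a multiple occurring for the twin `t` — the open step — and
amplify (`n`-th roots, `n → ∞`, then `ε → 0`).

* `stub_isotypicCompression` (provable-now, size L): `F(s)^n ≤ (n+1)^c · F(P_λ s^{⊗n})` for some
  occurring-or-arbitrary `λ ⊢ n` (character column orthogonality `∑_λ (f^λ/n!) ∑_π χ_λ(π) π = 1` on each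
  leg; `u + v ≤ u ⊕ v`; at most `(n+1)^{|ι|+|κ|+|μ|}` triples survive `schurWeyl_isotypicSum_eq_zero_holds`).
* `stub_twinSliceExtraction` (OPEN, the crux of the line): for twins `s`, `t` and every `ε > 0`,
  `F(P_λ s^{⊗n}) ≤ C_ε 2^{εn} F(t)^n` for all `n ≥ 1`, `λ ⊢ n`. TRUE for the gauge points (slice
  flattening rank `≤ dim` of the `λ_j`-isotypic component `≤ poly(n)·2^{nH(λ̄_j)}`, and `kλ_j` occurring
  for `t` has `≤ r_j(t)` parts) and for all quantum functionals (`E^θ ≤ ∑ θ_j log₂ ζ_j` on the slice,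
  `θ·H(λ̄) ≤ E^θ(t)` by admissibility of `kλ`); a dark (multiplicity-reading) point would break it.
* `PolytopeInvariance_of`: the amplification, kernel-checked below (tree lemma
  `le_of_forall_pow_le_polynomial_mul_pow`, continuity of `ε ↦ 2^ε` at `0`).

Disproof used: none registered for this crux yet (no `Disproof.lean`).
-/

set_option linter.dupNamespace false

noncomputable section

namespace Summit.MatrixMultiplication.MatrixMultiplication.Cruxes.PolytopeInvariance.Birth

open Literature.Computability.AlgebraicComplexity
open Filter Topology

/-- The crux, verbatim (route decl `Theses.IsotypicSaturation.PolytopeInvariance` after the split). -/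
def PolytopeInvariance : Prop :=
  ∀ F : Literature.Computability.AlgebraicComplexity.SpectralMap ℂ, Literature.Computability.AlgebraicComplexity.IsUniversalSpectralPoint ℂ F → ∀ {ι κ μ ι' κ' μ' : Type} [Fintype ι] [Fintype κ] [Fintype μ] [Fintype ι'] [Fintype κ'] [Fintype μ'] (s : ι → κ → μ → ℂ) (t : ι' → κ' → μ' → ℂ), (∀ (n : ℕ) (lam : Fin 3 → Nat.Partition n), 0 < n → Literature.Computability.AlgebraicComplexity.isotypicSum₁ (lam 0) (Literature.Computability.AlgebraicComplexity.isotypicSum₂ (lam 1) (Literature.Computability.AlgebraicComplexity.isotypicSum₃ (lam 2) (Literature.Computability.AlgebraicComplexity.kroneckerPow s n))) ≠ 0 → ∃ (k : ℕ) (mu : Fin 3 → Nat.Partition (k * n)), 0 < k ∧ (∀ j, (mu j).parts = (lam j).parts.map (fun p => k * p)) ∧ Literature.Computability.AlgebraicComplexity.isotypicSum₁ (mu 0) (Literature.Computability.AlgebraicComplexity.isotypicSum₂ (mu 1) (Literature.Computability.AlgebraicComplexity.isotypicSum₃ (mu 2) (Literature.Computability.AlgebraicComplexity.kroneckerPow t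 (k * n)))) ≠ 0) → (∀ (n : ℕ) (lam : Fin 3 → Nat.Partition n), 0 < n → Literature.Computability.AlgebraicComplexity.isotypicSum₁ (lam 0) (Literature.Computability.AlgebraicComplexity.isotypicSum₂ (lam 1) (Literature.Computability.AlgebraicComplexity.isotypicSum₃ (lam 2) (Literature.Computability.AlgebraicComplexity.kroneckerPow t n))) ≠ 0 → ∃ (k : ℕ) (mu : Fin 3 → Nat.Partition (k * n)), 0 < k ∧ (∀ j, (mu j).parts = (lam j).parts.map (fun p => k * p)) ∧ Literature.Computability.AlgebraicComplexity.isotypicSum₁ (mu 0) (Literature.Computability.AlgebraicComplexity.isotypicSum₂ (mu 1) (Literature.Computability.AlgebraicComplexity.isotypicSum₃ (mu 2) (Literature.Computability.AlgebraicComplexity.kroneckerPow s (k * n)))) ≠ 0) → F s = F t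

/-- **stub 1 — isotypic compression** (provable-now): `F(s)^n` is at most `poly(n)` times the
`F`-value of a single isotypic slice `P_λ s^{⊗n}` of the power. [size L] -/
theorem stub_isotypicCompression :
    ∀ F : SpectralMap ℂ, IsUniversalSpectralPoint ℂ F →
      ∀ {ι κ μ : Type} [Fintype ι] [Fintype κ] [Fintype μ] (s : ι → κ → μ → ℂ),
        ∃ c : ℕ, ∀ n : ℕ, 0 < n → ∃ lam : Fin 3 → Nat.Partition n,
          F s ^ n ≤ ((n : ℝ) + 1) ^ c * F (isotypicSum₁ (lam 0) (isotypicSum₂ (lam 1) (isotypicSum₃ (lam 2) (kroneckerPow s n)))) := by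
  sorry

/-- **stub 2 — twin slice extraction** (OPEN): for polytope-twins `s`, `t`, the `F`-value of every
isotypic slice of `s^{⊗n}` is at most `C_ε 2^{εn} F(t)^n`. [size XL] -/
theorem stub_twinSliceExtraction :
    ∀ F : SpectralMap ℂ, IsUniversalSpectralPoint ℂ F →
      ∀ {ι κ μ ι' κ' μ' : Type} [Fintype ι] [Fintype κ] [Fintype μ] [Fintype ι'] [Fintype κ']
        [Fintype μ'] (s : ι → κ → μ → ℂ) (t : ι' → κ' → μ' → ℂ),
        (∀ (n : ℕ) (lam : Fin 3 → Nat.Partition n), 0 < n → isotypicSum₁ (lam 0) (isotypicSum₂ (lam 1) (isotypicSum₃ (lam 2) (kroneckerPow s n))) ≠ 0 → ∃ (k : ℕ) (mu : Fin 3 → Nat.Partition (k * n)), 0 < k ∧ (∀ j, (mu j).parts = (lam j).parts.map (fun p => k * p)) ∧ isotypicSum₁ (mu 0) (isotypicSum₂ (mu 1) (isotypicSum₃ (mu 2) (kroneckerPow t (k * n)))) ≠ 0) →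
        (∀ (n : ℕ) (lam : Fin 3 → Nat.Partition n), 0 < n → isotypicSum₁ (lam 0) (isotypicSum₂ (lam 1) (isotypicSum₃ (lam 2) (kroneckerPow t n))) ≠ 0 → ∃ (k : ℕ) (mu : Fin 3 → Nat.Partition (k * n)), 0 < k ∧ (∀ j, (mu j).parts = (lam j).parts.map (fun p => k * p)) ∧ isotypicSum₁ (mu 0) (isotypicSum₂ (mu 1) (isotypicSum₃ (mu 2) (kroneckerPow s (k * n)))) ≠ 0) →
        ∀ ε : ℝ, 0 < ε → ∃ C : ℝ, ∀ (n : ℕ) (lam : Fin 3 → Nat.Partition n), 0 < n →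
          F (isotypicSum₁ (lam 0) (isotypicSum₂ (lam 1) (isotypicSum₃ (lam 2) (kroneckerPow s n)))) ≤ C * (2 : ℝ) ^ (ε * n) * F t ^ n := by
  sorry

/-- **Composition** (kernel-checked): compression + extraction ⟹ `F s ≤ 2^ε F t` for every `ε > 0`
by the polynomial-slack amplification lemma, then `ε → 0`; symmetry gives equality. -/
theorem PolytopeInvariance_of
    (h₁ : ∀ F : SpectralMap ℂ, IsUniversalSpectralPoint ℂ F →
      ∀ {ι κ μ : Type} [Fintype ι] [Fintype κ] [Fintype μ] (s : ι → κ → μ → ℂ),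
        ∃ c : ℕ, ∀ n : ℕ, 0 < n → ∃ lam : Fin 3 → Nat.Partition n,
          F s ^ n ≤ ((n : ℝ) + 1) ^ c * F (isotypicSum₁ (lam 0) (isotypicSum₂ (lam 1) (isotypicSum₃ (lam 2) (kroneckerPow s n)))))
    (h₂ : ∀ F : SpectralMap ℂ, IsUniversalSpectralPoint ℂ F →
      ∀ {ι κ μ ι' κ' μ' : Type} [Fintype ι] [Fintype κ] [Fintype μ] [Fintype ι'] [Fintype κ']
        [Fintype μ'] (s : ι → κ → μ → ℂ) (t : ι' → κ' → μ' → ℂ),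
        (∀ (n : ℕ) (lam : Fin 3 → Nat.Partition n), 0 < n → isotypicSum₁ (lam 0) (isotypicSum₂ (lam 1) (isotypicSum₃ (lam 2) (kroneckerPow s n))) ≠ 0 → ∃ (k : ℕ) (mu : Fin 3 → Nat.Partition (k * n)), 0 < k ∧ (∀ j, (mu j).parts = (lam j).parts.map (fun p => k * p)) ∧ isotypicSum₁ (mu 0) (isotypicSum₂ (mu 1) (isotypicSum₃ (mu 2) (kroneckerPow t (k * n)))) ≠ 0) →
        (∀ (n : ℕ) (lam : Fin 3 → Nat.Partition n), 0 < n → isotypicSum₁ (lam 0) (isotypicSum₂ (lam 1) (isotypicSum₃ (lam 2) (kroneckerPow t n))) ≠ 0 → ∃ (k : ℕ) (mu : Fin 3 → Nat.Partition (k * n)), 0 < k ∧ (∀ j, (mu j).parts = (lam j).parts.map (fun p => k * p)) ∧ isotypicSum₁ (mu 0) (isotypicSum₂ (mu 1) (isotypicSum₃ (mu 2) (kroneckerPow s (k * n)))) ≠ 0) →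
        ∀ ε : ℝ, 0 < ε → ∃ C : ℝ, ∀ (n : ℕ) (lam : Fin 3 → Nat.Partition n), 0 < n →
          F (isotypicSum₁ (lam 0) (isotypicSum₂ (lam 1) (isotypicSum₃ (lam 2) (kroneckerPow s n)))) ≤ C * (2 : ℝ) ^ (ε * n) * F t ^ n) :
    PolytopeInvariance := by
  -- one-sided comparison of twins
  have main : ∀ F : SpectralMap ℂ, IsUniversalSpectralPoint ℂ F →
      ∀ {ι κ μ ι' κ' μ' : Type} [Fintype ι] [Fintype κ] [Fintype μ] [Fintype ι'] [Fintype κ']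
        [Fintype μ'] (s : ι → κ → μ → ℂ) (t : ι' → κ' → μ' → ℂ),
        (∀ (n : ℕ) (lam : Fin 3 → Nat.Partition n), 0 < n → isotypicSum₁ (lam 0) (isotypicSum₂ (lam 1) (isotypicSum₃ (lam 2) (kroneckerPow s n))) ≠ 0 → ∃ (k : ℕ) (mu : Fin 3 → Nat.Partition (k * n)), 0 < k ∧ (∀ j, (mu j).parts = (lam j).parts.map (fun p => k * p)) ∧ isotypicSum₁ (mu 0) (isotypicSum₂ (mu 1) (isotypicSum₃ (mu 2) (kroneckerPow t (k * n)))) ≠ 0) →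
        (∀ (n : ℕ) (lam : Fin 3 → Nat.Partition n), 0 < n → isotypicSum₁ (lam 0) (isotypicSum₂ (lam 1) (isotypicSum₃ (lam 2) (kroneckerPow t n))) ≠ 0 → ∃ (k : ℕ) (mu : Fin 3 → Nat.Partition (k * n)), 0 < k ∧ (∀ j, (mu j).parts = (lam j).parts.map (fun p => k * p)) ∧ isotypicSum₁ (mu 0) (isotypicSum₂ (mu 1) (isotypicSum₃ (mu 2) (kroneckerPow s (k * n)))) ≠ 0) → F s ≤ F t := by
    intro F hF ι κ μ ι' κ' μ' _ _ _ _ _ _ s t hst hts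
    obtain ⟨c, hc⟩ := h₁ F hF s
    -- for every `ε > 0`: `F s ≤ 2^ε · F t`
    have hε : ∀ ε : ℝ, 0 < ε → F s ≤ (2 : ℝ) ^ ε * F t := by
      intro ε hε
      obtain ⟨C, hC⟩ := h₂ F hF s t hst hts ε hε
      refine le_of_forall_pow_le_polynomial_mul_pow (F s) ((2 : ℝ) ^ ε * F t) (max C 1) c
        (mul_nonneg (Real.rpow_nonneg zero_le_two ε) (hF.nonneg t)) fun N => ?_
      rcases Nat.eq_zero_or_pos N with rfl | hN
      · simp
      · obtain ⟨lam, hlam⟩ := hc N hN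
        have h2 := hC N lam hN
        have hpow : (2 : ℝ) ^ (ε * (N : ℕ)) = ((2 : ℝ) ^ ε) ^ N := by
          rw [Real.rpow_mul zero_le_two, Real.rpow_natCast]
        have hX : 0 ≤ ((N : ℝ) + 1) ^ c * (((2 : ℝ) ^ ε) ^ N * F t ^ N) := by
          have := hF.nonneg t
          positivity
        calc F s ^ N ≤ ((N : ℝ) + 1) ^ c *
              F (isotypicSum₁ (lam 0) (isotypicSum₂ (lam 1) (isotypicSum₃ (lam 2) (kroneckerPow s N)))) :=
              hlam
          _ ≤ ((N : ℝ) + 1) ^ c * (C * (2 : ℝ) ^ (ε * (N : ℕ)) * F t ^ N) :=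
              mul_le_mul_of_nonneg_left h2 (by positivity)
          _ = C * (((N : ℝ) + 1) ^ c * (((2 : ℝ) ^ ε) ^ N * F t ^ N)) := by rw [hpow]; ring
          _ ≤ max C 1 * (((N : ℝ) + 1) ^ c * (((2 : ℝ) ^ ε) ^ N * F t ^ N)) :=
              mul_le_mul_of_nonneg_right (le_max_left _ _) hX
          _ = max C 1 * ((N : ℝ) + 1) ^ c * ((2 : ℝ) ^ ε * F t) ^ N := by rw [mul_pow]; ring
    -- `ε → 0⁺`
    have hcont : Tendsto (fun ε : ℝ => (2 : ℝ) ^ ε * F t) (𝓝[>] 0) (𝓝 ((2 : ℝ) ^ (0 : ℝ) * F t)) :=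
      (((Real.continuousAt_const_rpow two_ne_zero).mul continuousAt_const).tendsto).mono_left
        nhdsWithin_le_nhds
    rw [Real.rpow_zero, one_mul] at hcont
    exact ge_of_tendsto hcont (eventually_nhdsWithin_of_forall fun ε hε' => hε ε hε')
  intro F hF ι κ μ ι' κ' μ' _ _ _ _ _ _ s t hst hts
  exact le_antisymm (main F hF s t hst hts) (main F hF t s hts hst)

end Summit.MatrixMultiplication.MatrixMultiplication.Cruxes.PolytopeInvariance.Birth

end
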